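import Summits.AtomisticToContinuum.BoseEinsteinCondensation.Theorems.BECPhaseQuadratureSumRuleCurrentSumRuleAmplitudes
import Literature.MathematicalPhysics.QuantumManyBody.PuffCubicMomentBlocks
import Literature.MathematicalPhysics.QuantumManyBody.PeriodicFormCauchySchwarz

/-!
# Route `BECPhaseQuadratureSumRule`, support `CurrentSumRule` (stmt-AtomisticToContinuum-12618), II:
# the real engine — the shifted form at `ρ_k u` and at `A_k u` for a real solution `u`

Supports stmt-AtomisticToContinuum-12618. For a *real* `C³` lattice-periodic `u` on the torus
`(ℝ³/Lℤ³)^N` solving `-Δu + Vu = Eu` pointwise (`V ∈ C²` real, lattice periodic), a mode `m`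
(`k = 2πm/L`, `κ = ‖k‖²`, `eⱼ = e^{ik·xⱼ}`, `∂ⱼ = k·∇_{xⱼ}`), the density wave `ρ_k u = (∑ⱼeⱼ)u`, the
commutator amplitude `A = ∑ⱼ eⱼ(κu - 2i∂ⱼu) = (H-E)(ρ_k u)` and `B = (H-E)A` (Puff), and the shifted
form `q_W(φ) = ∫ (|∇φ|² + W|φ|²)`, `W = V - E`, with polar pairing `b_W(η, φ)`:

* `formPairing_rhoAmp`, `formPairing_commAmp` — `b_W(η, ρ_k u) = Re ∫ conj(η) A`,
  `b_W(η, A) = Re ∫ conj(η) B` for every `C¹` periodic `η` (Green's identity and the commutator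
  identities `puff_first_commutator`, `puff_second_commutator`);
* `form_rhoAmp` — **f-sum rule** `q_W(ρ_k u) = Nκ ∫u²`;
* `form_commAmp` — **Puff's cubic moment** `q_W(A) = κ³N∫u² + 12κ∫∑ⱼ(∂ⱼu)² + 2Re∫u²∑_{j,l}eⱼēₗ∂ₗ∂ⱼV`;
* `re_integral_sq_mul_phaseHessian_le` — for the periodic pair interaction `V = ∑_{a<b}v^per(x_{ab})`
  the potential term is `≤ 4∫u²∑_{a<b}(1 - cos k·x_{ab})|∂_k∂_k v^per(x_{ab})|` (phase sum).

References: R. D. Puff, Phys. Rev. 137 (1965) A406, (11)–(15); S. Stringari, in *Bose–Einstein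
Condensation* (CUP 1995) §2.3 (20)–(23).
-/

noncomputable section

namespace Summit.AtomisticToContinuum.BoseEinsteinCondensation.Theorems

open MeasureTheory
open scoped ENNReal NNReal BigOperators ComplexConjugate
open Literature.MathematicalPhysics.QuantumManyBody.BoseGas

namespace CurrentSumRule

variable {N : ℕ} {L : ℝ}

/-! ### The shifted form as its own polar pairing -/

/-- `|z|² = Re(conj(z) z)`. [folklore] -/
theorem norm_sq_eq_re_conj_mul_self (z : ℂ) : ‖z‖ ^ 2 = (conj z * z).re := by
  rw [Complex.sq_norm, Complex.normSq_apply]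
  simp only [Complex.mul_re, Complex.conj_re, Complex.conj_im]
  ring

/-- The shifted form at `φ` is its polar pairing at `(φ, φ)`, pointwise. [folklore] -/
theorem form_self_eq_pairing (W : Config N → ℝ) (φ : Config N → ℂ) (X : Config N) :
    kineticDensityReal φ X + W X * ‖φ X‖ ^ 2 =
      (∑ i : Fin N, ∑ a : Fin 3, (conj (fderiv ℝ φ X (Pi.single i (EuclideanSpace.single a (1 : ℝ)))) *
        fderiv ℝ φ X (Pi.single i (EuclideanSpace.single a (1 : ℝ)))).re) + W X * (conj (φ X) * φ X).re := by
  rw [kineticDensityReal, norm_sq_eq_re_conj_mul_self]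
  congr 1
  exact Finset.sum_congr rfl fun i _ => Finset.sum_congr rfl fun a _ => norm_sq_eq_re_conj_mul_self _

/-- `Re ∫ conj(φ) φ = ∫ |φ|²` for continuous `φ` on the cell. [folklore] -/
theorem re_integral_conj_mul_self {φ : Config N → ℂ} (hφ : Continuous φ) (L : ℝ) :
    (∫ X in cellN N L, conj (φ X) * φ X).re = ∫ X in cellN N L, ‖φ X‖ ^ 2 := by
  have hint : Integrable (fun X => conj (φ X) * φ X) (volume.restrict (cellN N L)) :=
    integrableOn_cellN ((Complex.continuous_conj.comp hφ).mul hφ) L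
  rw [← Complex.reCLM_apply (∫ X in cellN N L, _), ← ContinuousLinearMap.integral_comp_comm _ hint]
  refine integral_congr_ae (ae_of_all _ fun X => ?_)
  simp only [Complex.reCLM_apply]
  exact (norm_sq_eq_re_conj_mul_self _).symm

/-! ### The engine for a real solution of the equation -/

section Engine

variable (m : Fin 3 → ℤ) {k : Space} {u V W : Config N → ℝ} {E : ℝ}

/-- **Pairing with the density wave.** For a real `C²` lattice-periodic solution `u` of
`-Δu + Vu = Eu` (`V` continuous), `W = V - E`, and every `C¹` periodic test amplitude `η`:
`b_W(η, ρ_k u) = Re ∫ conj(η) A` with `A = ∑ⱼ eⱼ(κu - 2i∂ⱼu)` (Green's identity and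
`(H - E)(ρ_k u) = A`). [cite: Stringari1995, §2.3 (20)] -/
theorem formPairing_rhoAmp (hL : 0 < L) (hk : k = (2 * Real.pi / L) • latticeVec 1 m)
    (hu : ContDiff ℝ 2 u) (huper : IsLatticePeriodic L u) (hV : Continuous V)
    (hWVE : ∀ X, W X = V X - E)
    (hEq : ∀ X : Config N, -(∑ i : Fin N, ∑ a : Fin 3, fderiv ℝ (fun Y => fderiv ℝ u Y
        (Pi.single i (EuclideanSpace.single a (1 : ℝ)))) X (Pi.single i (EuclideanSpace.single a (1 : ℝ)))) +
      V X * u X = E * u X)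
    {η : Config N → ℂ} (hη : ContDiff ℝ 1 η)
    (hηper : ∀ (X : Config N) (i : Fin N) (c : Fin 3),
      η (X + Pi.single i (EuclideanSpace.single c L)) = η X) :
    ∫ X in cellN N L, ((∑ i : Fin N, ∑ a : Fin 3,
        (conj (fderiv ℝ η X (Pi.single i (EuclideanSpace.single a (1 : ℝ)))) *
          fderiv ℝ (fun Y : Config N => (∑ j : Fin N, cellWave L m (Y j)) * ((u Y : ℝ) : ℂ)) X
            (Pi.single i (EuclideanSpace.single a (1 : ℝ)))).re) +
        W X * (conj (η X) * ((∑ j : Fin N, cellWave L m (X j)) * ((u X : ℝ) : ℂ))).re) =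
      (∫ X in cellN N L, conj (η X) * ∑ j : Fin N, cellWave L m (X j) *
        ((((‖k‖ ^ 2 : ℝ) : ℂ)) * ((u X : ℝ) : ℂ) - 2 * Complex.I * ((fderiv ℝ u X (Pi.single j k) : ℝ) : ℂ))).re := by
  have hWc : Continuous W := by
    have h : W = fun X => V X - E := funext hWVE
    rw [h]
    exact hV.sub continuous_const
  rw [form_pairing_eq_re_integral hL hWc hη (contDiff_rhoAmp L m hu) hηper
    (rhoAmp_periodic L m hL.ne' huper)]
  congr 1
  refine integral_congr_ae (ae_of_all _ fun X => ?_)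
  dsimp only
  rw [hWVE X, ← puff_first_commutator m hk hu hEq X]

/-- **Pairing with the commutator amplitude.** For a real `C³` lattice-periodic solution `u` of
`-Δu + Vu = Eu` with `V ∈ C¹`, `W = V - E`, and every `C¹` periodic `η`: `b_W(η, A) = Re ∫ conj(η) B`
with Puff's `B = ∑ⱼ eⱼ(κ²u - 4iκ∂ⱼu - 4∂ⱼ∂ⱼu + 2i(∂ⱼV)u) = (H - E)A`. [cite: Puff1965, Eq. (11)] -/
theorem formPairing_commAmp (hL : 0 < L) (hk : k = (2 * Real.pi / L) • latticeVec 1 m)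
    (hu : ContDiff ℝ 3 u) (huper : IsLatticePeriodic L u) (hV : ContDiff ℝ 1 V)
    (hWVE : ∀ X, W X = V X - E)
    (hEq : ∀ X : Config N, -(∑ i : Fin N, ∑ a : Fin 3, fderiv ℝ (fun Y => fderiv ℝ u Y
        (Pi.single i (EuclideanSpace.single a (1 : ℝ)))) X (Pi.single i (EuclideanSpace.single a (1 : ℝ)))) +
      V X * u X = E * u X)
    {η : Config N → ℂ} (hη : ContDiff ℝ 1 η)
    (hηper : ∀ (X : Config N) (i : Fin N) (c : Fin 3),
      η (X + Pi.single i (EuclideanSpace.single c L)) = η X) :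
    ∫ X in cellN N L, ((∑ i : Fin N, ∑ a : Fin 3,
        (conj (fderiv ℝ η X (Pi.single i (EuclideanSpace.single a (1 : ℝ)))) *
          fderiv ℝ (fun Y : Config N => ∑ j : Fin N, cellWave L m (Y j) *
            ((((‖k‖ ^ 2 : ℝ) : ℂ)) * ((u Y : ℝ) : ℂ) - 2 * Complex.I * ((fderiv ℝ u Y (Pi.single j k) : ℝ) : ℂ))) X
            (Pi.single i (EuclideanSpace.single a (1 : ℝ)))).re) +
        W X * (conj (η X) * ∑ j : Fin N, cellWave L m (X j) *
            ((((‖k‖ ^ 2 : ℝ) : ℂ)) * ((u X : ℝ) : ℂ) - 2 * Complex.I * ((fderiv ℝ u X (Pi.single j k) : ℝ) : ℂ))).re) =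
      (∫ X in cellN N L, conj (η X) * ∑ j : Fin N, cellWave L m (X j) *
        ((((‖k‖ ^ 2 : ℝ) : ℂ)) ^ 2 * ((u X : ℝ) : ℂ) -
          4 * Complex.I * ((‖k‖ ^ 2 : ℝ) : ℂ) * ((fderiv ℝ u X (Pi.single j k) : ℝ) : ℂ) -
          4 * ((fderiv ℝ (fun Y => fderiv ℝ u Y (Pi.single j k)) X (Pi.single j k) : ℝ) : ℂ) +
          2 * Complex.I * ((fderiv ℝ V X (Pi.single j k) : ℝ) : ℂ) * ((u X : ℝ) : ℂ))).re := by
  have hWc : Continuous W := by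
    have h : W = fun X => V X - E := funext hWVE
    rw [h]
    exact hV.continuous.sub continuous_const
  rw [form_pairing_eq_re_integral hL hWc hη (contDiff_commAmp L m hu _ k) hηper
    (commAmp_periodic L m hL.ne' huper _ k)]
  congr 1
  refine integral_congr_ae (ae_of_all _ fun X => ?_)
  dsimp only
  rw [hWVE X, ← puff_second_commutator m hk hu hV hEq X]

/-- **The f-sum rule as a value of the shifted form**: `q_W(ρ_k u) = Nκ ∫ u²` for a real `C²`
lattice-periodic solution `u` of `-Δu + Vu = Eu`, `W = V - E`. [cite: Stringari1995, §2.3 (20)] -/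
theorem form_rhoAmp (hL : 0 < L) (hk : k = (2 * Real.pi / L) • latticeVec 1 m)
    (hu : ContDiff ℝ 2 u) (huper : IsLatticePeriodic L u) (hV : Continuous V)
    (hWVE : ∀ X, W X = V X - E)
    (hEq : ∀ X : Config N, -(∑ i : Fin N, ∑ a : Fin 3, fderiv ℝ (fun Y => fderiv ℝ u Y
        (Pi.single i (EuclideanSpace.single a (1 : ℝ)))) X (Pi.single i (EuclideanSpace.single a (1 : ℝ)))) +
      V X * u X = E * u X) :
    ∫ X in cellN N L, (kineticDensityReal (fun Y : Config N => (∑ j : Fin N, cellWave L m (Y j)) * ((u Y : ℝ) : ℂ)) X +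
        W X * ‖(∑ j : Fin N, cellWave L m (X j)) * ((u X : ℝ) : ℂ)‖ ^ 2) =
      (N : ℝ) * ‖k‖ ^ 2 * ∫ X in cellN N L, u X ^ 2 := by
  simp_rw [form_self_eq_pairing W (fun Y : Config N => (∑ j : Fin N, cellWave L m (Y j)) * ((u Y : ℝ) : ℂ))]
  rw [formPairing_rhoAmp m hL hk hu huper hV hWVE hEq (contDiff_rhoAmp L m (hu.of_le (by norm_num)))
      (rhoAmp_periodic L m hL.ne' huper),
    integral_conj_rhoAmp_mul_commAmp m hL hk (hu.of_le (by norm_num)) huper, Complex.ofReal_re]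

/-- **Puff's cubic moment as a value of the shifted form**: for a real `C³` lattice-periodic
solution `u` of `-Δu + Vu = Eu` with `V ∈ C²` lattice periodic and `W = V - E`,
`q_W(A) = κ³N∫u² + 12κ∫∑ⱼ(∂ⱼu)² + 2Re∫u²∑_{j,l}eⱼēₗ∂ₗ∂ⱼV` (`A = ∑ⱼeⱼ(κu - 2i∂ⱼu)`).
[cite: Puff1965, (15)] -/
theorem form_commAmp (hL : 0 < L) (hk : k = (2 * Real.pi / L) • latticeVec 1 m)
    (hu : ContDiff ℝ 3 u) (huper : IsLatticePeriodic L u) (hV : ContDiff ℝ 2 V)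
    (hVper : IsLatticePeriodic L V) (hWVE : ∀ X, W X = V X - E)
    (hEq : ∀ X : Config N, -(∑ i : Fin N, ∑ a : Fin 3, fderiv ℝ (fun Y => fderiv ℝ u Y
        (Pi.single i (EuclideanSpace.single a (1 : ℝ)))) X (Pi.single i (EuclideanSpace.single a (1 : ℝ)))) +
      V X * u X = E * u X) :
    ∫ X in cellN N L, (kineticDensityReal (fun Y : Config N => ∑ j : Fin N, cellWave L m (Y j) *
          ((((‖k‖ ^ 2 : ℝ) : ℂ)) * ((u Y : ℝ) : ℂ) - 2 * Complex.I * ((fderiv ℝ u Y (Pi.single j k) : ℝ) : ℂ))) X +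
        W X * ‖∑ j : Fin N, cellWave L m (X j) *
          ((((‖k‖ ^ 2 : ℝ) : ℂ)) * ((u X : ℝ) : ℂ) - 2 * Complex.I * ((fderiv ℝ u X (Pi.single j k) : ℝ) : ℂ))‖ ^ 2) =
      ‖k‖ ^ 6 * N * (∫ X in cellN N L, u X ^ 2) +
        12 * ‖k‖ ^ 2 * (∫ X in cellN N L, ∑ j : Fin N, fderiv ℝ u X (Pi.single j k) ^ 2) +
        2 * (∫ X in cellN N L, ((u X ^ 2 : ℝ) : ℂ) * ∑ j : Fin N, ∑ l : Fin N,
          cellWave L m (X j) * conj (cellWave L m (X l)) *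
            ((fderiv ℝ (fun Y => fderiv ℝ V Y (Pi.single j k)) X (Pi.single l k) : ℝ) : ℂ)).re := by
  simp_rw [form_self_eq_pairing W (fun Y : Config N => ∑ j : Fin N, cellWave L m (Y j) *
    ((((‖k‖ ^ 2 : ℝ) : ℂ)) * ((u Y : ℝ) : ℂ) - 2 * Complex.I * ((fderiv ℝ u Y (Pi.single j k) : ℝ) : ℂ)))]
  rw [formPairing_commAmp m hL hk hu huper (hV.of_le (by norm_num)) hWVE hEq
      (contDiff_one_commAmp L m (hu.of_le (by norm_num)) _ k) (commAmp_periodic L m hL.ne' huper _ k)]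
  exact puff_cubic_moment_pairing m hL hk (hu.of_le (by norm_num)) hV huper hVper

end Engine

/-! ### The potential term for the periodic pair interaction -/

section Potential

variable {v : ℝ → ℝ≥0∞} {R₀ : ℝ} (m : Fin 3 → ℤ) {k : Space}

/-- **The potential term of Puff's cubic moment, bounded by the phase-weighted Hessian.** For a
finite profile `v` of range `R₀` with `ṽ(y) = v(|y|) ∈ C²`, `2R₀ < L`, `V = ∑_{a<b} v^per(x_a - x_b)`,
`k = 2πm/L` and a continuous real `u`:
`Re ∫ u² ∑_{j,l} eⱼēₗ ∂ₗ∂ⱼV ≤ 2 ∫ u² ∑_{a<b} (1 - cos k·(x_a - x_b)) |∂_k∂_k v^per(x_a - x_b)|`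
(the phase sum `∑_{j,l} eⱼēₗ∂ₗ∂ⱼV = ∑_{a<b}|e_a - e_b|²∂_k∂_kv^per(x_{ab})` and
`|e_a - e_b|² = 2(1 - cos k·x_{ab})`). [cite: Stringari1995, §2.3 (23)] -/
theorem re_integral_sq_mul_phaseHessian_le (hv : ∀ r, R₀ < r → v r = 0) (h2R : 2 * R₀ < L)
    (hL : 0 < L) (hfin : ∀ r, v r ≠ ⊤) (hC : ContDiff ℝ 2 (fun x : Space => (v ‖x‖).toReal))
    (hk : k = (2 * Real.pi / L) • latticeVec 1 m) {u : Config N → ℝ} (hu : Continuous u) :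
    (∫ X in cellN N L, ((u X ^ 2 : ℝ) : ℂ) * ∑ j : Fin N, ∑ l : Fin N,
        cellWave L m (X j) * conj (cellWave L m (X l)) *
          ((fderiv ℝ (fun Y : Config N => fderiv ℝ (fun Z : Config N => (periodicInteraction v L Z).toReal) Y
            (Pi.single j k)) X (Pi.single l k) : ℝ) : ℂ)).re ≤
      2 * ∫ X in cellN N L, u X ^ 2 * ∑ a : Fin N, ∑ b : Fin N with a < b,
        (1 - Real.cos (inner ℝ k (X a - X b))) *
          |fderiv ℝ (fun x => fderiv ℝ (fun z => (periodizedPotential v L z).toReal) x k) (X a - X b) k| := by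
  set Hf : Space → ℝ := fun y =>
    fderiv ℝ (fun x => fderiv ℝ (fun z => (periodizedPotential v L z).toReal) x k) y k with hHf
  -- the phase sum, pointwise
  have hS : ∀ X : Config N, ((u X ^ 2 : ℝ) : ℂ) * ∑ j : Fin N, ∑ l : Fin N,
      cellWave L m (X j) * conj (cellWave L m (X l)) *
        ((fderiv ℝ (fun Y : Config N => fderiv ℝ (fun Z : Config N => (periodicInteraction v L Z).toReal) Y
          (Pi.single j k)) X (Pi.single l k) : ℝ) : ℂ) =
      ((u X ^ 2 * ∑ a : Fin N, ∑ b : Fin N with a < b,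
        ‖cellWave L m (X a) - cellWave L m (X b)‖ ^ 2 * Hf (X a - X b) : ℝ) : ℂ) := by
    intro X
    simp_rw [fderiv_fderiv_toReal_periodicInteraction_single hv h2R hL hfin hC]
    rw [sum_phase_mul_pairCoeff_eq (fun j => cellWave L m (X j)) (fun a b => Hf (X a - X b))]
    push_cast
    ring
  simp_rw [hS]
  rw [integral_complex_ofReal, Complex.ofReal_re, ← integral_const_mul]
  -- continuity of the Hessian profile
  have hp : ContDiff ℝ 2 (fun y => (periodizedPotential v L y).toReal) :=
    contDiff_toReal_periodizedPotential hv h2R hL hC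
  have hD1 : ContDiff ℝ 1 (fun x => fderiv ℝ (fun y => (periodizedPotential v L y).toReal) x k) :=
    (hp.fderiv_right (m := 1) (by norm_num)).clm_apply contDiff_const
  have hHfc : Continuous Hf := (hD1.continuous_fderiv one_ne_zero).clm_apply continuous_const
  have hce : ∀ j : Fin N, Continuous fun X : Config N => cellWave L m (X j) := fun j =>
    (contDiff_cellWave L m).continuous.comp (continuous_apply j)
  have hab : ∀ a b : Fin N, Continuous fun X : Config N => X a - X b := fun a b =>
    (continuous_apply a).sub (continuous_apply b)
  have hi1 : Integrable (fun X : Config N => u X ^ 2 * ∑ a : Fin N, ∑ b : Fin N with a < b,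
      ‖cellWave L m (X a) - cellWave L m (X b)‖ ^ 2 * Hf (X a - X b)) (volume.restrict (cellN N L)) := by
    refine integrableOn_cellN ((hu.pow 2).mul (continuous_finsetSum _ fun a _ =>
      continuous_finsetSum _ fun b _ => ?_)) L
    exact (((hce a).sub (hce b)).norm.pow 2).mul (hHfc.comp (hab a b))
  have hi2 : Integrable (fun X : Config N => 2 * (u X ^ 2 * ∑ a : Fin N, ∑ b : Fin N with a < b,
      (1 - Real.cos (inner ℝ k (X a - X b))) * |Hf (X a - X b)|)) (volume.restrict (cellN N L)) := by
    refine integrableOn_cellN (continuous_const.mul ((hu.pow 2).mul (continuous_finsetSum _ fun a _ =>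
      continuous_finsetSum _ fun b _ => ?_))) L
    exact (continuous_const.sub (Real.continuous_cos.comp (continuous_const.inner (hab a b)))).mul
      ((continuous_abs.comp hHfc).comp (hab a b))
  refine integral_mono hi1 hi2 fun X => ?_
  dsimp only
  rw [← mul_assoc, mul_comm (2 : ℝ) (u X ^ 2), mul_assoc]
  refine mul_le_mul_of_nonneg_left ?_ (sq_nonneg (u X))
  rw [Finset.mul_sum]
  refine Finset.sum_le_sum fun a _ => ?_
  rw [Finset.mul_sum]
  refine Finset.sum_le_sum fun b _ => ?_
  rw [norm_cellWave_sub_cellWave_sq, ← hk]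
  have h0 : 0 ≤ 1 - Real.cos (inner ℝ k (X a - X b)) := sub_nonneg.2 (Real.cos_le_one _)
  calc 2 * (1 - Real.cos (inner ℝ k (X a - X b))) * Hf (X a - X b)
      ≤ 2 * (1 - Real.cos (inner ℝ k (X a - X b))) * |Hf (X a - X b)| :=
        mul_le_mul_of_nonneg_left (le_abs_self _) (mul_nonneg zero_le_two h0)
    _ = 2 * ((1 - Real.cos (inner ℝ k (X a - X b))) * |Hf (X a - X b)|) := by ring

end Potential

end CurrentSumRule

end Summit.AtomisticToContinuum.BoseEinsteinCondensation.Theorems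

end
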